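import Summits.ABC.IUTFork.Joshi.ArithmeticoidProperties
import Summits.ABC.IUTFork.Joshi.ArithmeticoidPeriods
import Mathlib.FieldTheory.IsAlgClosed.Basic

/-!
# SUPPLIER DISCHARGE of two [J-2½] claim-`Prop`s of `Joshi/ArithmeticoidProperties.lean` — Lem. 5.1.3 (`Lem513`) and Thm. 5.5.2 (3)–(4)
# (`Thm552_34`) — from «`K_v` is an algebraically closed perfectoid field» (Def. 5.1.1), arXiv:2305.10398 §5

Block E proof-only file (cell abc-iut, rung LADDER-ABC:A2.E, seat abc-iut-E-t46; pattern T-55: a hypothesis `Prop` another seat isolated, derived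
from the typed objects BY NAME). Seat E-t37's `ATS2h.DeformationDatum` (p430482) records the residue fields `K_{y_v}` of the arithmeticoid as
abstract fields; print's Def. 5.1.1 (p.29 l.49–58, p.34 l.32–33: «the local data of `arith(L)` at `v` provides an algebraically closed perfectoid
field `K_v`») has them ALGEBRAICALLY CLOSED. Under exactly that hypothesis (a typeclass assumption on the carriers, no new `Prop` fact; it is also
the `IsAlgClosed` clause of E-t37's claims `Prop472` / `Prop483` for the variants `𝒴^max_L` / `𝒴^ℝ_L`) the two claim-`Prop`s
* `DeformationDatum.Lem513` — [J-2½] Lem. 5.1.3 (p.30 l.26–41): «every non-constant polynomial `f(T) ∈ L[T] ⊂ R[T]` has a root in `R = ∏_v K_v`»,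
* `DeformationDatum.Thm552_34` — [J-2½] Thm. 5.5.2 (3)–(4) (p.34 l.22–25, proof l.32–35): every non-constant polynomial over `L_v` has a root in
  the algebraic closure `L̄_v ⊂ K_v` of `L_v` inside `K_v`,
are THEOREMS: `lem513_of_isAlgClosed`, `thm552_34_of_isAlgClosed` (roots chosen coordinatewise by `IsAlgClosed.exists_eval₂_eq_zero`), and the
claim-to-claim reductions `lem513_of_prop472` / `thm552_34_of_prop472` / `lem513_of_prop483` / `thm552_34_of_prop483`. TAKES NO SIDE on [IUTchIII]
Cor. 3.12, on Joshi's claims, or on Mochizuki's reports on them; typed ≠ proved for everything not derived here. Source conventions as in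
p430482 ([J-2½] = K. Joshi, arXiv:2305.10398, bib `Joshi2023ATS2half`; «p.N l.M» = render `HOME/plan/repair/lit/renders/Joshi-arxiv-2305.10398-ATS2half/`).
-/

noncomputable section

namespace Summit.ABC.IUTFork.Joshi.ATS2h

namespace DeformationDatum

variable {L : Type} [Field L] {V : Type} {Lv : V → Type} [∀ v, Field (Lv v)] {Y : V → Type}
  [∀ v, TopologicalSpace (Y v)] {K : (v : V) → Y v → Type} [∀ v y, Field (K v y)] [∀ v y, TopologicalSpace (K v y)]
  {G : V → Type} [∀ v, Group (G v)] {A : V → Type} [∀ v, Group (A v)]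
  (D : DeformationDatum L V Lv Y K G A)

/-- A polynomial of positive `natDegree` has `degree ≠ 0`. [folklore] -/
private theorem degree_ne_zero_of_natDegree_pos {R : Type} [Semiring R] {f : Polynomial R} (hf : 0 < f.natDegree) : f.degree ≠ 0 :=
  ne_of_gt (Polynomial.natDegree_pos_iff_degree_pos.mp hf)

/-- **[J-2½] Thm. 5.5.2 (3)–(4) DISCHARGED** from «`K_v` algebraically closed» (Def. 5.1.1): every non-constant polynomial over `L_v` has a root in
`K_{y_v}` (`IsAlgClosed.exists_eval₂_eq_zero` along `ι_{y_v} : L_v ↪ K_{y_v}`), and any such root lies in `L̄_v = algClosureIn y v` (witnessed by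
the polynomial itself). [claim: Joshi2023ATS2half, status: disputed] -/
theorem thm552_34_of_isAlgClosed [∀ v (y : Y v), IsAlgClosed (K v y)] : D.Thm552_34 := by
  intro y v f hf
  obtain ⟨x, hx⟩ := IsAlgClosed.exists_eval₂_eq_zero (D.emb v (y v)) f (degree_ne_zero_of_natDegree_pos hf)
  exact ⟨x, ⟨f, fun h0 => by simp [h0] at hf, hx⟩, hx⟩

/-- **[J-2½] Lem. 5.1.3 DISCHARGED** from «`K_v` algebraically closed» (Def. 5.1.1): «every non-constant polynomial `f(T) ∈ L[T] ⊂ R[T]` has a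
root in `R`» — choose a root of `f` in each `K_{y_v}` along `ι_{y_v} : L → K_{y_v}`; the tuple of roots is a root in `R_y = ∏_v K_{y_v}` (print's
«elementary considerations», p.30 l.40–41). [claim: Joshi2023ATS2half, status: disputed] -/
theorem lem513_of_isAlgClosed [∀ v (y : Y v), IsAlgClosed (K v y)] : D.Lem513 := by
  intro y f hf
  have h : ∀ v, ∃ x : K v (y v), Polynomial.eval₂ (D.iota y v) x f = 0 := fun v =>
    IsAlgClosed.exists_eval₂_eq_zero (D.iota y v) f (degree_ne_zero_of_natDegree_pos hf)
  choose x hx using h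
  refine ⟨x, funext fun v => ?_⟩
  have := Polynomial.hom_eval₂ f (D.iotaL y) (Pi.evalRingHom (fun v => K v (y v)) v) x
  rw [Pi.evalRingHom_apply] at this
  rw [Pi.zero_apply, this]
  exact hx v

/-- Lem. 5.1.3 for the maximally complete variant `𝒴^max_L`, from E-t37's claim `Prop472` (whose clause (1) carries `IsAlgClosed (K_{y_v})`).
Claim-to-claim reduction. [claim: Joshi2023ATS2half, status: disputed] -/
theorem lem513_of_prop472 (h472 : D.Prop472) (h : D.IsDef471) : D.Lem513 := by
  haveI : ∀ v (y : Y v), IsAlgClosed (K v y) := fun v y₀ => by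
    classical
    obtain ⟨y, rfl⟩ : ∃ y : D.Ycal, y v = y₀ := ⟨Function.update (fun w => D.pt0 w) v y₀, Function.update_self v y₀ _⟩
    exact (h472 h y v).2.1
  exact D.lem513_of_isAlgClosed

/-- Thm. 5.5.2 (3)–(4) for `𝒴^max_L`, from `Prop472`. Claim-to-claim reduction. [claim: Joshi2023ATS2half, status: disputed] -/
theorem thm552_34_of_prop472 (h472 : D.Prop472) (h : D.IsDef471) : D.Thm552_34 := by
  haveI : ∀ v (y : Y v), IsAlgClosed (K v y) := fun v y₀ => by
    classical
    obtain ⟨y, rfl⟩ : ∃ y : D.Ycal, y v = y₀ := ⟨Function.update (fun w => D.pt0 w) v y₀, Function.update_self v y₀ _⟩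
    exact (h472 h y v).2.1
  exact D.thm552_34_of_isAlgClosed

/-- Lem. 5.1.3 for the realified variant `𝒴^ℝ_L`, from E-t37's claim `Prop483`. Claim-to-claim reduction. [claim: Joshi2023ATS2half, status: disputed] -/
theorem lem513_of_prop483 (h483 : D.Prop483) (h : D.IsDef481) : D.Lem513 := by
  haveI : ∀ v (y : Y v), IsAlgClosed (K v y) := fun v y₀ => by
    classical
    obtain ⟨y, rfl⟩ : ∃ y : D.Ycal, y v = y₀ := ⟨Function.update (fun w => D.pt0 w) v y₀, Function.update_self v y₀ _⟩
    exact (h483 h y v).2.1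
  exact D.lem513_of_isAlgClosed

/-- Thm. 5.5.2 (3)–(4) for `𝒴^ℝ_L`, from `Prop483`. Claim-to-claim reduction. [claim: Joshi2023ATS2half, status: disputed] -/
theorem thm552_34_of_prop483 (h483 : D.Prop483) (h : D.IsDef481) : D.Thm552_34 := by
  haveI : ∀ v (y : Y v), IsAlgClosed (K v y) := fun v y₀ => by
    classical
    obtain ⟨y, rfl⟩ : ∃ y : D.Ycal, y v = y₀ := ⟨Function.update (fun w => D.pt0 w) v y₀, Function.update_self v y₀ _⟩
    exact (h483 h y v).2.1
  exact D.thm552_34_of_isAlgClosed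

end DeformationDatum

end Summit.ABC.IUTFork.Joshi.ATS2h
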